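import Mathlib.Computability.PartrecCode
import Mathlib.Analysis.SpecialFunctions.Pow.Real
import Literature.Computability.Complexity.ComputableRealProofs
import HarnessLib

/-!
# A computable real number which is not elementary (Yoshinaga 2008, §2.3)

M. Yoshinaga, *Periods and elementary real numbers*, arXiv:0805.0349 (2008), proves (§3.1,
Thm. 18) that every real Kontsevich–Zagier period is an *elementary real number* (Def. 9 there;
the tree's `Literature.Computability.Complexity.IsElementaryReal`, in the three-sequence form of
Tent–Ziegler 2010), and (§2.3, Prop. 17) constructs by a diagonal argument a *computable* real
number `α` which is not elementary; "so the real number `α` constructed above is not a period"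
(§3.1). This file formalises the recursion-theoretic half, §2.3:

* `Literature.Computability.Complexity.exists_isComputableReal_not_isElementaryReal`:
  there is a real number which is computable (`IsComputableReal`: it has a computable fast Cauchy
  name `ℕ → ℚ`, Weihrauch 2000, Def. 4.1.13) and not elementary (`IsElementaryReal`).

Together with Thm. 18 (the named fact
`Literature.NumberTheory.Transcendental.isElementaryReal_of_isRealPeriod`) it yields a computable
non-period (`Literature.NumberTheory.Transcendental.exists_isComputableReal_not_isRealPeriod`).

## The printed proof and this formalisation

Yoshinaga (§2.3) enumerates all elementary functions `f_e` through Mazzanti's four-function basis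
(Prop. 13), forms the elementary maps `g_e = f_{L e} / (f_{R e} + 1) : ℕ → ℚ`, regularises them to
`7`-fast Cauchy sequences `ḡ_e` with limits `β_e` (so that `{β_e} = ℝ_elem`, Lemma 12, Def. 15),
and defines `α = Σ 2 ε_n 3^{-n}` by `ε_{n+1} = 0` if `ḡ_n(n) > α_n + 1/(2·3^n)` and `ε_{n+1} = 1`
otherwise (eq. before Prop. 17); then `α ∈ [α_n, α_n + 3^{-n}]` for all `n` and `α ≠ β_e` for
every `e` (Prop. 17), and `α` is computable because `(e, n) ↦ f_e(n)` is.

We run the same nested-interval diagonalisation with two inessential changes.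
(1) *Enumeration.* Instead of Mazzanti's basis we enumerate, by Mathlib's Gödel numbering of
`Nat.Partrec.Code`, all **primitive recursive** functions through a total computable universal
function `primrecEnum` (`codeTotalEval`: evaluate a code reading the unbounded search `rfind'` as
`0`; it is computable because it factors through Mathlib's universal partial recursive function
`Nat.Partrec.Code.eval` and the primitive recursive code transformation `codeTotalize`). Every
Kalmár elementary function is primitive recursive (`ElementaryRec.primrec_holds`, Rose 1984), so
diagonalising against all triples `(a, b, c)` of enumerated functions in the defining condition
`|x - (a n - b n)/(c n + 1)| ≤ 1/(n+1)` of `IsElementaryReal` excludes in particular all elementary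
reals. (2) *Precision instead of regularisation.* At stage `e = ⟨e₁, e₂, e₃⟩` we read the
candidate approximation `g = (a N - b N)/(c N + 1)` at the single precision `N = N_e = 4·3^(e+1)`
(`YoshinagaDiagonal.diagBound`): if `(a, b, c)` are witnesses for a real `β` then
`β ∈ [g - 1/(N+1), g + 1/(N+1)]`, an interval of length `< 3^{-(e+1)}/2`, which therefore misses
either the left or the right third of the current interval `[α_e, α_e + 3^{-e}]`; the ternary digit
`d_e ∈ {0, 2}` (`YoshinagaDiagonal.diagDigit`, decided in integer arithmetic by
`YoshinagaDiagonal.diagTest`) picks a third avoiding it. The limit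
`x = sup_e α_e` (`YoshinagaDiagonal.diagReal`, `α_e = A_e/3^e`, `A_{e+1} = 3 A_e + d_e`) satisfies
`|x - α_e| ≤ 3^{-e} ≤ 2^{-e}`, and `e ↦ α_e` is a computable map `ℕ → ℚ` for Mathlib's
`Primcodable ℚ` (by the rational coding lemmas of `ComputableRealProofs`), so `x` is computable;
and `x` is not elementary (`YoshinagaDiagonal.not_isElementaryReal_diagReal`).

## References

* M. Yoshinaga, *Periods and elementary real numbers*, arXiv:0805.0349 (2008), §2.2 (Def. 6,
  Def. 9), §2.3 (Prop. 13, Def. 15, Prop. 17), §3.1 (Thm. 18). [cite: Yoshinaga2008, §2.3 Prop. 17]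
* H. E. Rose, *Subrecursion: functions and hierarchies*, Oxford Logic Guides 9 (1984), Ch. 1
  (elementary ⊆ primitive recursive).
* K. Weihrauch, *Computable Analysis* (2000), Def. 4.1.13 (computable real numbers).
* Mathlib: `Nat.Partrec.Code`, `Nat.Partrec.Code.eval_part` (universal partial recursive
  function), `Nat.Partrec.Code.primrec_recOn` (structural recursion on codes is primitive
  recursive), `Partrec.of_eq_tot`, `Computable.nat_rec`.

## Design notes

* No new named facts: everything in this file is proved. The only new `Prop`-valued statement is
  the theorem `exists_isComputableReal_not_isElementaryReal` (Prop. 17 in existential form; the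
  printed `α` depends on the printed enumeration, ours on Mathlib's coding, so only the existential
  statement is common to both and it is all that §3.1 uses).
* The construction lives in the sub-namespace `YoshinagaDiagonal`; the universal function
  (`codeTotalEval`, `codeTotalize`, `primrecEnum`) is of independent use and sits directly in
  `Literature.Computability.Complexity`. Mathlib (searched `evaln`, `Code.eval`, `Primrec`,
  `universal`) has the universal *partial* recursive function and `evaln`, but no total universal
  function for the primitive recursive functions and no Kalmár-elementary class.
-/

namespace Literature.Computability.Complexity

open Encodable Denumerable
open Nat.Partrec (Code)

/-! ### A total universal function for the primitive recursive functions -/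

/-- Total evaluation of a partial-recursive code (Mathlib's `Nat.Partrec.Code`): the constructors
`zero, succ, left, right, pair, comp, prec` are interpreted as in `Nat.Partrec.Code.eval`, and the
unbounded search `rfind'` is interpreted as the constant `0`. On `rfind'`-free codes (codes of
primitive recursive functions) this is the usual evaluation. [folklore] -/
def codeTotalEval : Code → ℕ → ℕ
  | .zero => fun _ => 0
  | .succ => Nat.succ
  | .left => fun n => n.unpair.1
  | .right => fun n => n.unpair.2
  | .pair cf cg => fun n => Nat.pair (codeTotalEval cf n) (codeTotalEval cg n)
  | .comp cf cg => fun n => codeTotalEval cf (codeTotalEval cg n)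
  | .prec cf cg =>
      Nat.unpaired fun a n => n.rec (codeTotalEval cf a) fun y IH => codeTotalEval cg (Nat.pair a (Nat.pair y IH))
  | .rfind' _ => fun _ => 0

/-- Totalisation of a code: replace every `rfind'` subcode by `zero`. [folklore] -/
def codeTotalize : Code → Code
  | .zero => .zero
  | .succ => .succ
  | .left => .left
  | .right => .right
  | .pair cf cg => .pair (codeTotalize cf) (codeTotalize cg)
  | .comp cf cg => .comp (codeTotalize cf) (codeTotalize cg)
  | .prec cf cg => .prec (codeTotalize cf) (codeTotalize cg)
  | .rfind' _ => .zero

/-- `codeTotalize` written with the recursor of `Nat.Partrec.Code` (for `Code.primrec_recOn`). [folklore] -/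
theorem codeTotalize_eq_recOn (c : Code) :
    codeTotalize c = Nat.Partrec.Code.recOn c Code.zero Code.succ Code.left Code.right
      (fun _ _ tf tg => Code.pair tf tg) (fun _ _ tf tg => Code.comp tf tg)
      (fun _ _ tf tg => Code.prec tf tg) (fun _ _ => Code.zero) := by
  induction c with
  | zero => rfl
  | succ => rfl
  | left => rfl
  | right => rfl
  | pair cf cg ihf ihg => rw [codeTotalize, ihf, ihg]
  | comp cf cg ihf ihg => rw [codeTotalize, ihf, ihg]
  | prec cf cg ihf ihg => rw [codeTotalize, ihf, ihg]
  | rfind' cf _ => rfl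

/-- `codeTotalize : Code → Code` is primitive recursive (structural recursion on codes,
`Nat.Partrec.Code.primrec_recOn`). [folklore] -/
theorem codeTotalize_primrec : Primrec codeTotalize := by
  have h := Nat.Partrec.Code.primrec_recOn (α := Code) (σ := Code) Primrec.id
    (z := fun _ => Code.zero) (Primrec.const _)
    (s := fun _ => Code.succ) (Primrec.const _)
    (l := fun _ => Code.left) (Primrec.const _)
    (r := fun _ => Code.right) (Primrec.const _)
    (pr := fun _ _ _ tf tg => Code.pair tf tg)
    (Nat.Partrec.Code.primrec₂_pair.comp
      (Primrec.fst.comp (Primrec.snd.comp (Primrec.snd.comp Primrec.snd)))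
      (Primrec.snd.comp (Primrec.snd.comp (Primrec.snd.comp Primrec.snd))))
    (co := fun _ _ _ tf tg => Code.comp tf tg)
    (Nat.Partrec.Code.primrec₂_comp.comp
      (Primrec.fst.comp (Primrec.snd.comp (Primrec.snd.comp Primrec.snd)))
      (Primrec.snd.comp (Primrec.snd.comp (Primrec.snd.comp Primrec.snd))))
    (pc := fun _ _ _ tf tg => Code.prec tf tg)
    (Nat.Partrec.Code.primrec₂_prec.comp
      (Primrec.fst.comp (Primrec.snd.comp (Primrec.snd.comp Primrec.snd)))
      (Primrec.snd.comp (Primrec.snd.comp (Primrec.snd.comp Primrec.snd))))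
    (rf := fun _ _ _ => Code.zero) (Primrec.const _)
  exact h.of_eq fun c => (codeTotalize_eq_recOn c).symm

/-- The totalised code evaluates, under Mathlib's universal partial recursive function
`Nat.Partrec.Code.eval`, to the total evaluation `codeTotalEval`. [folklore] -/
theorem eval_codeTotalize (c : Code) : (codeTotalize c).eval = fun n => Part.some (codeTotalEval c n) := by
  induction c with
  | zero => funext n; simp [codeTotalize, Nat.Partrec.Code.eval, codeTotalEval, pure, PFun.pure]
  | succ => rfl
  | left => rfl
  | right => rfl
  | pair cf cg ihf ihg =>
      funext n
      simp [codeTotalize, Nat.Partrec.Code.eval, codeTotalEval, ihf, ihg, Seq.seq]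
  | comp cf cg ihf ihg =>
      funext n
      simp [codeTotalize, Nat.Partrec.Code.eval, codeTotalEval, ihf, ihg]
  | prec cf cg ihf ihg =>
      funext n
      simp only [codeTotalize, Nat.Partrec.Code.eval, codeTotalEval, ihf, ihg, Nat.unpaired, Part.bind_eq_bind]
      induction n.unpair.2 with
      | zero => simp
      | succ m IH => simp [IH]
  | rfind' cf _ => funext n; simp [codeTotalize, Nat.Partrec.Code.eval, codeTotalEval, pure, PFun.pure]

/-- The universal function of this file: `primrecEnum e` is the total evaluation of the `e`-th code.
Every primitive recursive function is `primrecEnum e` for some `e` (`exists_primrecEnum_eq`) and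
`primrecEnum` is (jointly) computable (`primrecEnum_computable`); it is of course not primitive
recursive itself (a standard fact of recursion theory: the primitive recursive functions have a
recursive, but no primitive recursive, universal function). [folklore] -/
def primrecEnum (e n : ℕ) : ℕ :=
  codeTotalEval (ofNat Code e) n

/-- The universal function `primrecEnum` is computable, as a function of the pair (code, input):
it is the composition of Mathlib's universal partial recursive function `Nat.Partrec.Code.eval`
(`Code.eval_part`) with the primitive recursive `codeTotalize`, and it is total. [folklore] -/
theorem primrecEnum_computable : Computable₂ primrecEnum := by
  have h1 : Computable fun p : ℕ × ℕ => codeTotalize (ofNat Code p.1) :=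
    (codeTotalize_primrec.to_comp.comp (Computable.ofNat Code)).comp Computable.fst
  have h2 : Partrec fun p : ℕ × ℕ => (codeTotalize (ofNat Code p.1)).eval p.2 :=
    Nat.Partrec.Code.eval_part.comp h1 Computable.snd
  refine Partrec.of_eq_tot h2 fun p => ?_
  rw [eval_codeTotalize]
  exact Part.mem_some _

/-- Every primitive recursive function occurs in the enumeration `primrecEnum`. Proof: by
induction on `Nat.Primrec`, each constructor is matched by the corresponding (`rfind'`-free) code
constructor, on which `codeTotalEval` computes the intended function by definition. [folklore] -/
theorem exists_primrecEnum_eq {f : ℕ → ℕ} (hf : Nat.Primrec f) : ∃ e, primrecEnum e = f := by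
  obtain ⟨c, hc⟩ : ∃ c : Code, codeTotalEval c = f := by
    induction hf with
    | zero => exact ⟨.zero, rfl⟩
    | succ => exact ⟨.succ, rfl⟩
    | left => exact ⟨.left, rfl⟩
    | right => exact ⟨.right, rfl⟩
    | pair _ _ ihf ihg =>
        obtain ⟨cf, rfl⟩ := ihf
        obtain ⟨cg, rfl⟩ := ihg
        exact ⟨.pair cf cg, rfl⟩
    | comp _ _ ihf ihg =>
        obtain ⟨cf, rfl⟩ := ihf
        obtain ⟨cg, rfl⟩ := ihg
        exact ⟨.comp cf cg, rfl⟩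
    | prec _ _ ihf ihg =>
        obtain ⟨cf, rfl⟩ := ihf
        obtain ⟨cg, rfl⟩ := ihg
        exact ⟨.prec cf cg, rfl⟩
  refine ⟨encode c, ?_⟩
  funext n
  rw [primrecEnum, ofNat_encode, hc]

/-- Every Kalmár elementary function occurs in the enumeration `primrecEnum` (elementary functions
are primitive recursive, `ElementaryRec.primrec_holds`). [folklore] -/
theorem exists_primrecEnum_eq_of_elementaryRec {f : ℕ → ℕ} (hf : ElementaryRec f) :
    ∃ e, primrecEnum e = f :=
  exists_primrecEnum_eq (ElementaryRec.primrec_holds hf)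


/-! ### Rational sequences with computable numerator–denominator code -/

/-- A map into `ℚ` is computable (for Mathlib's `Primcodable ℚ`) as soon as its
numerator–denominator code is (computable analogue of `primrec_rat_of_numDenCode`: the Mathlib code
of a rational is the primitive recursive rank `rank_ratNumDenCode_primrec` of that code,
`rat_encode_eq_rank`). [folklore] -/
theorem computable_rat_of_numDenCode {α : Type*} [Primcodable α] {f : α → ℚ}
    (hf : Computable fun a => Nat.pair (Equiv.intEquivNat (f a).num) (f a).den) : Computable f := by
  letI := @Encodable.decidableRangeEncode ℚ Rat.instEncodable
  exact Computable.encode_iff.1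
    ((rank_ratNumDenCode_primrec.to_comp.comp hf).of_eq fun a => (rat_encode_eq_rank (f a)).symm)

/-! ### The diagonal construction (Yoshinaga 2008, §2.3) -/

/-- `n ↦ 3 ^ n` is primitive recursive. [folklore] -/
theorem pow_three_primrec : Primrec fun e : ℕ => 3 ^ e :=
  (Primrec₂.unpaired'.1 Nat.Primrec.pow).comp (Primrec.const 3) Primrec.id

namespace YoshinagaDiagonal

/-- The precision used at stage `e` of the diagonalisation: `N_e = 4 · 3^(e+1)`, so that
`2/(N_e+1) < 3^{-(e+1)}`. [cite: Yoshinaga2008, §2.3] -/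
def diagBound (e : ℕ) : ℕ :=
  4 * 3 ^ (e + 1)

/-- `diagBound` is primitive recursive. [folklore] -/
theorem diagBound_primrec : Primrec diagBound :=
  Primrec.nat_mul.comp (Primrec.const 4) (pow_three_primrec.comp Primrec.succ)

/-- The stage-`e` test of the diagonalisation, in integer arithmetic. With `a` the current
numerator (`α_e = a/3^e`), `N = diagBound e` and `u₁ u₂ u₃` the values at `N` of the `e`-th triple
of enumerated functions, it decides whether
`α_e + 3^{-(e+1)} < (u₁ - u₂)/(u₃ + 1) - 1/(N+1)` (`diagTest_eq_true_iff`), i.e. whether the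
interval of radius `1/(N+1)` about the `e`-th candidate approximation lies strictly to the right
of the left third of `[α_e, α_e + 3^{-e}]`. [cite: Yoshinaga2008, §2.3] -/
def diagTest (e a u₁ u₂ u₃ : ℕ) : Bool :=
  decide ((3 * a + 1) * (u₃ + 1) * (diagBound e + 1) + u₂ * (diagBound e + 1) * 3 ^ (e + 1) +
      (u₃ + 1) * 3 ^ (e + 1) < u₁ * (diagBound e + 1) * 3 ^ (e + 1))

/-- `diagTest` is primitive recursive in its five arguments. [folklore] -/
theorem diagTest_primrec :
    Primrec fun p : ℕ × ℕ × ℕ × ℕ × ℕ => diagTest p.1 p.2.1 p.2.2.1 p.2.2.2.1 p.2.2.2.2 := by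
  have he : Primrec fun p : ℕ × ℕ × ℕ × ℕ × ℕ => p.1 := Primrec.fst
  have ha : Primrec fun p : ℕ × ℕ × ℕ × ℕ × ℕ => p.2.1 := Primrec.fst.comp Primrec.snd
  have hu₁ : Primrec fun p : ℕ × ℕ × ℕ × ℕ × ℕ => p.2.2.1 :=
    Primrec.fst.comp (Primrec.snd.comp Primrec.snd)
  have hu₂ : Primrec fun p : ℕ × ℕ × ℕ × ℕ × ℕ => p.2.2.2.1 :=
    Primrec.fst.comp (Primrec.snd.comp (Primrec.snd.comp Primrec.snd))
  have hu₃ : Primrec fun p : ℕ × ℕ × ℕ × ℕ × ℕ => p.2.2.2.2 :=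
    Primrec.snd.comp (Primrec.snd.comp (Primrec.snd.comp Primrec.snd))
  have hP : Primrec fun p : ℕ × ℕ × ℕ × ℕ × ℕ => 3 ^ (p.1 + 1) :=
    pow_three_primrec.comp (Primrec.succ.comp he)
  have hN : Primrec fun p : ℕ × ℕ × ℕ × ℕ × ℕ => diagBound p.1 + 1 :=
    Primrec.succ.comp (diagBound_primrec.comp he)
  have hu₃' : Primrec fun p : ℕ × ℕ × ℕ × ℕ × ℕ => p.2.2.2.2 + 1 := Primrec.succ.comp hu₃
  have ha' : Primrec fun p : ℕ × ℕ × ℕ × ℕ × ℕ => 3 * p.2.1 + 1 :=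
    Primrec.succ.comp (Primrec.nat_mul.comp (Primrec.const 3) ha)
  have hT₁ : Primrec fun p : ℕ × ℕ × ℕ × ℕ × ℕ =>
      (3 * p.2.1 + 1) * (p.2.2.2.2 + 1) * (diagBound p.1 + 1) +
        p.2.2.2.1 * (diagBound p.1 + 1) * 3 ^ (p.1 + 1) + (p.2.2.2.2 + 1) * 3 ^ (p.1 + 1) :=
    Primrec.nat_add.comp
      (Primrec.nat_add.comp
        (Primrec.nat_mul.comp (Primrec.nat_mul.comp ha' hu₃') hN)
        (Primrec.nat_mul.comp (Primrec.nat_mul.comp hu₂ hN) hP))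
      (Primrec.nat_mul.comp hu₃' hP)
  have hT₀ : Primrec fun p : ℕ × ℕ × ℕ × ℕ × ℕ => p.2.2.1 * (diagBound p.1 + 1) * 3 ^ (p.1 + 1) :=
    Primrec.nat_mul.comp (Primrec.nat_mul.comp hu₁ hN) hP
  exact (Primrec.nat_lt.decide.comp hT₁ hT₀).of_eq fun p => rfl

/-- The ternary digit (`0` or `2`) chosen at stage `e` of the diagonalisation when the current
numerator is `a`: the index `e` is read as a triple `(e₁, e₂, e₃)` of codes through `Nat.unpair`,
the three enumerated functions are evaluated at the precision `diagBound e` by the universal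
function `primrecEnum`, and the digit is `0` (keep the left third) if the test `diagTest` holds and
`2` (move to the right third) otherwise. (Yoshinaga 2008, §2.3, the definition of `ε_{n+1}`,
with his enumeration `ḡ_n` replaced by `primrecEnum`.) [cite: Yoshinaga2008, §2.3] -/
def diagDigit (e a : ℕ) : ℕ :=
  bif diagTest e a (primrecEnum e.unpair.1 (diagBound e))
      (primrecEnum e.unpair.2.unpair.1 (diagBound e))
      (primrecEnum e.unpair.2.unpair.2 (diagBound e)) then 0 else 2

/-- `diagDigit` is computable (it is built from the computable universal function `primrecEnum`
and primitive recursive arithmetic). [folklore] -/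
theorem diagDigit_computable : Computable₂ diagDigit := by
  have hN : Computable fun p : ℕ × ℕ => diagBound p.1 :=
    diagBound_primrec.to_comp.comp Computable.fst
  have h₁ : Computable fun p : ℕ × ℕ => primrecEnum p.1.unpair.1 (diagBound p.1) :=
    primrecEnum_computable.comp (Computable.fst.comp (Computable.unpair.comp Computable.fst)) hN
  have h₂ : Computable fun p : ℕ × ℕ => primrecEnum p.1.unpair.2.unpair.1 (diagBound p.1) :=
    primrecEnum_computable.comp
      (Computable.fst.comp (Computable.unpair.comp
        (Computable.snd.comp (Computable.unpair.comp Computable.fst)))) hN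
  have h₃ : Computable fun p : ℕ × ℕ => primrecEnum p.1.unpair.2.unpair.2 (diagBound p.1) :=
    primrecEnum_computable.comp
      (Computable.snd.comp (Computable.unpair.comp
        (Computable.snd.comp (Computable.unpair.comp Computable.fst)))) hN
  -- `have h := …; exact h`: elaborating the composition against the expected type would
  -- trigger an expensive higher-order unification through `decide`.
  have hT : Computable fun p : ℕ × ℕ =>
      diagTest p.1 p.2 (primrecEnum p.1.unpair.1 (diagBound p.1))
        (primrecEnum p.1.unpair.2.unpair.1 (diagBound p.1))
        (primrecEnum p.1.unpair.2.unpair.2 (diagBound p.1)) := by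
    have h := diagTest_primrec.to_comp.comp
      (Computable.fst.pair (Computable.snd.pair (h₁.pair (h₂.pair h₃))))
    exact h
  have hc : Computable fun p : ℕ × ℕ =>
      bif diagTest p.1 p.2 (primrecEnum p.1.unpair.1 (diagBound p.1))
        (primrecEnum p.1.unpair.2.unpair.1 (diagBound p.1))
        (primrecEnum p.1.unpair.2.unpair.2 (diagBound p.1)) then 0 else 2 :=
    Computable.cond hT (Computable.const 0) (Computable.const 2)
  exact hc

/-- The numerators `A_e` of the diagonal sequence `α_e = A_e / 3^e`: `A_0 = 0`,
`A_{e+1} = 3 A_e + d_e` with `d_e ∈ {0, 2}` the digit chosen at stage `e`.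
(Yoshinaga 2008, §2.3, the sequence `α_n`, up to the replacement of his enumeration by
`primrecEnum`.) [cite: Yoshinaga2008, §2.3] -/
def diagNum : ℕ → ℕ
  | 0 => 0
  | e + 1 => 3 * diagNum e + diagDigit e (diagNum e)

/-- `diagNum` is computable (primitive recursion along the computable step `diagDigit`).
[folklore] -/
theorem diagNum_computable : Computable diagNum := by
  have hstep' : Computable fun q : ℕ × ℕ × ℕ => 3 * q.2.2 + diagDigit q.2.1 q.2.2 :=
    Primrec.nat_add.to_comp.comp
      (Primrec.nat_mul.to_comp.comp (Computable.const 3) (Computable.snd.comp Computable.snd))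
      (diagDigit_computable.comp (Computable.fst.comp Computable.snd)
        (Computable.snd.comp Computable.snd))
  have hstep : Computable₂ fun (_ : ℕ) (p : ℕ × ℕ) => 3 * p.2 + diagDigit p.1 p.2 := hstep'.to₂
  refine (Computable.nat_rec Computable.id (Computable.const 0) hstep).of_eq fun e => ?_
  induction e with
  | zero => rfl
  | succ e ih => exact congrArg (fun t => 3 * t + diagDigit e t) ih

/-- The rational fast Cauchy name of the diagonal real: `diagSeq e = A_e / 3^e`, written as
`mkRat (A_e - 0) ((3^e - 1) + 1)` to match `ratNumDenCode_mkRat_sub_primrec`. [cite: Yoshinaga2008, §2.3] -/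
def diagSeq (e : ℕ) : ℚ :=
  mkRat ((diagNum e : ℤ) - ((0 : ℕ) : ℤ)) (3 ^ e - 1 + 1)

/-- `diagSeq : ℕ → ℚ` is computable (for Mathlib's `Primcodable ℚ`). [folklore] -/
theorem diagSeq_computable : Computable diagSeq := by
  have hC : Computable fun e : ℕ => 3 ^ e - 1 :=
    (Primrec.nat_sub.comp pow_three_primrec (Primrec.const 1)).to_comp
  refine computable_rat_of_numDenCode ?_
  exact (ratNumDenCode_mkRat_sub_primrec.to_comp.comp
    (diagNum_computable.pair ((Computable.const 0).pair hC))).of_eq fun e => rfl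

/-! ### Analysis of the diagonal sequence -/

/-- The diagonal approximants `α_e = A_e / 3^e` as real numbers. [cite: Yoshinaga2008, §2.3] -/
noncomputable def diagApprox (e : ℕ) : ℝ :=
  (diagNum e : ℝ) / 3 ^ e

/-- The digits are at most `2`. [folklore] -/
theorem diagDigit_le_two (e a : ℕ) : diagDigit e a ≤ 2 := by
  unfold diagDigit
  cases diagTest _ _ _ _ _ <;> simp

/-- One step of the diagonal sequence: `α_{e+1} = α_e + d_e / 3^{e+1}`. [folklore] -/
theorem diagApprox_succ (e : ℕ) :
    diagApprox (e + 1) = diagApprox e + (diagDigit e (diagNum e) : ℝ) / 3 ^ (e + 1) := by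
  simp only [diagApprox, diagNum]
  push_cast
  field_simp
  ring

/-- The diagonal sequence is non-decreasing. [folklore] -/
theorem diagApprox_le_succ (e : ℕ) : diagApprox e ≤ diagApprox (e + 1) := by
  rw [diagApprox_succ]
  exact le_add_of_nonneg_right (by positivity)

/-- One step moves by at most `2 / 3^{e+1}`. [folklore] -/
theorem diagApprox_succ_le (e : ℕ) : diagApprox (e + 1) ≤ diagApprox e + 2 / 3 ^ (e + 1) := by
  rw [diagApprox_succ, add_le_add_iff_left]
  exact div_le_div_of_nonneg_right (by exact_mod_cast diagDigit_le_two e (diagNum e))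
    (by positivity)

/-- The diagonal sequence is monotone. [folklore] -/
theorem diagApprox_mono : Monotone diagApprox :=
  monotone_nat_of_le_succ diagApprox_le_succ

/-- Nested intervals: `α_{e+k} ≤ α_e + 3^{-e} - 3^{-(e+k)}`. [folklore] -/
theorem diagApprox_add_le (e k : ℕ) :
    diagApprox (e + k) ≤ diagApprox e + 1 / 3 ^ e - 1 / 3 ^ (e + k) := by
  induction k with
  | zero => simp
  | succ k ih =>
    calc diagApprox (e + (k + 1)) = diagApprox (e + k + 1) := by rw [add_assoc]
      _ ≤ diagApprox (e + k) + 2 / 3 ^ (e + k + 1) := diagApprox_succ_le _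
      _ ≤ diagApprox e + 1 / 3 ^ e - 1 / 3 ^ (e + k) + 2 / 3 ^ (e + k + 1) := by linarith [ih]
      _ = diagApprox e + 1 / 3 ^ e - 1 / 3 ^ (e + (k + 1)) := by
        rw [← add_assoc]
        field_simp
        ring

/-- Every approximant lies below `α_e + 3^{-e}`, for every `e`. [folklore] -/
theorem diagApprox_le_add_inv (e e' : ℕ) : diagApprox e' ≤ diagApprox e + 1 / 3 ^ e := by
  rcases le_or_gt e e' with h | h
  · obtain ⟨k, rfl⟩ := Nat.exists_eq_add_of_le h
    have h1 := diagApprox_add_le e k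
    have h2 : (0 : ℝ) < 1 / 3 ^ (e + k) := by positivity
    linarith
  · have h1 := diagApprox_mono h.le
    have h2 : (0 : ℝ) < 1 / 3 ^ e := by positivity
    linarith

/-- The diagonal sequence is bounded above. [folklore] -/
theorem bddAbove_range_diagApprox : BddAbove (Set.range diagApprox) :=
  ⟨diagApprox 0 + 1 / 3 ^ 0, by
    rintro _ ⟨e', rfl⟩
    exact diagApprox_le_add_inv 0 e'⟩

/-- **The diagonal real number** `x = sup_e α_e = ∑ d_e 3^{-(e+1)}` (Yoshinaga 2008, §2.3, the
number `α = lim α_n`, for the enumeration `primrecEnum`). [cite: Yoshinaga2008, §2.3] -/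
noncomputable def diagReal : ℝ :=
  ⨆ e, diagApprox e

/-- `α_e ≤ x`. [folklore] -/
theorem diagApprox_le_diagReal (e : ℕ) : diagApprox e ≤ diagReal :=
  le_ciSup bddAbove_range_diagApprox e

/-- `x ≤ α_e + 3^{-e}`. [folklore] -/
theorem diagReal_le (e : ℕ) : diagReal ≤ diagApprox e + 1 / 3 ^ e :=
  ciSup_le fun e' => diagApprox_le_add_inv e e'

/-- `|x - α_e| ≤ 3^{-e}` (Yoshinaga 2008, §2.3, eq. after Prop. 17: `α ∈ [α_n, α_n + 3^{-n}]`).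
[cite: Yoshinaga2008, §2.3] -/
theorem abs_diagReal_sub_diagApprox_le (e : ℕ) : |diagReal - diagApprox e| ≤ 1 / 3 ^ e := by
  rw [abs_le]
  constructor
  · have h1 := diagApprox_le_diagReal e
    have h2 : (0 : ℝ) < 1 / 3 ^ e := by positivity
    linarith
  · linarith [diagReal_le e]

/-- The rational name `diagSeq e` is the approximant `α_e`. [folklore] -/
theorem diagSeq_cast (e : ℕ) : ((diagSeq e : ℚ) : ℝ) = diagApprox e := by
  have h3 : 3 ^ e - 1 + 1 = 3 ^ e := Nat.sub_add_cancel (Nat.one_le_pow e 3 (by norm_num))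
  rw [diagSeq, h3, Rat.mkRat_eq_div, diagApprox]
  push_cast
  ring

/-- **The diagonal real is computable**: `diagSeq` is a computable fast Cauchy name of it, since
`|x - α_e| ≤ 3^{-e} ≤ 2^{-e}` (Yoshinaga 2008, §2.3: "we construct a non-elementary computable
real number"). [cite: Yoshinaga2008, §2.3] -/
theorem isComputableReal_diagReal : IsComputableReal diagReal := by
  refine ⟨diagSeq, diagSeq_computable, fun e => ?_⟩
  rw [diagSeq_cast]
  refine (abs_diagReal_sub_diagApprox_le e).trans ?_
  calc (1 : ℝ) / 3 ^ e ≤ 1 / 2 ^ e :=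
        one_div_le_one_div_of_le (pow_pos two_pos e) (by gcongr; norm_num)
    _ = (1 / 2) ^ e := by rw [one_div_pow]

/-- The integer test `diagTest` decides the real inequality
`a/3^e + 3^{-(e+1)} < (u₁ - u₂)/(u₃ + 1) - 1/(N_e + 1)`. [folklore] -/
theorem diagTest_eq_true_iff (e a u₁ u₂ u₃ : ℕ) :
    diagTest e a u₁ u₂ u₃ = true ↔
      (a : ℝ) / 3 ^ e + 1 / 3 ^ (e + 1) < ((u₁ : ℝ) - u₂) / (u₃ + 1) - 1 / (diagBound e + 1) := by
  have hP : (0 : ℝ) < 3 ^ (e + 1) := by positivity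
  have hN : (0 : ℝ) < (diagBound e : ℝ) + 1 := by positivity
  have hu : (0 : ℝ) < (u₃ : ℝ) + 1 := by positivity
  rw [diagTest, decide_eq_true_iff]
  rw [show (a : ℝ) / 3 ^ e = 3 * a / 3 ^ (e + 1) by
    rw [pow_succ, mul_comm (3 : ℝ) (a : ℝ), mul_div_mul_right _ _ (by norm_num : (3 : ℝ) ≠ 0)]]
  rw [lt_sub_iff_add_lt, ← add_div, div_add_div _ _ hP.ne' hN.ne',
    div_lt_div_iff₀ (mul_pos hP hN) hu]
  constructor
  · intro h
    have h' : ((3 * a + 1) * (u₃ + 1) * (diagBound e + 1) + u₂ * (diagBound e + 1) * 3 ^ (e + 1) +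
        (u₃ + 1) * 3 ^ (e + 1) : ℝ) < u₁ * (diagBound e + 1) * 3 ^ (e + 1) := by exact_mod_cast h
    linarith
  · intro h
    have h' : ((3 * a + 1) * (u₃ + 1) * (diagBound e + 1) + u₂ * (diagBound e + 1) * 3 ^ (e + 1) +
        (u₃ + 1) * 3 ^ (e + 1) : ℝ) < u₁ * (diagBound e + 1) * 3 ^ (e + 1) := by linarith
    exact_mod_cast h'

/-- **The diagonal real is not elementary** (Yoshinaga 2008, §2.3, Prop. 17, for the enumeration
`primrecEnum`): if `a b c` were elementary witnesses for `x`, take codes `e₁ e₂ e₃` of `a b c` in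
the enumeration and the stage `e = ⟨e₁, e₂, e₃⟩`; at precision `N = diagBound e` the interval of
radius `1/(N+1)` about `(a N - b N)/(c N + 1)` contains `x` but, by the choice of the digit `d_e`,
misses the third `[α_{e+1}, α_{e+1} + 3^{-(e+1)}]` that contains `x`. [cite: Yoshinaga2008, §2.3] -/
theorem not_isElementaryReal_diagReal : ¬ IsElementaryReal diagReal := by
  rintro ⟨a, b, c, ha, hb, hc, hx⟩
  obtain ⟨e₁, he₁⟩ := exists_primrecEnum_eq_of_elementaryRec ha
  obtain ⟨e₂, he₂⟩ := exists_primrecEnum_eq_of_elementaryRec hb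
  obtain ⟨e₃, he₃⟩ := exists_primrecEnum_eq_of_elementaryRec hc
  obtain ⟨e, h1, h2, h3⟩ :
      ∃ e : ℕ, e.unpair.1 = e₁ ∧ e.unpair.2.unpair.1 = e₂ ∧ e.unpair.2.unpair.2 = e₃ :=
    ⟨Nat.pair e₁ (Nat.pair e₂ e₃), by simp, by simp, by simp⟩
  have hdigit : diagDigit e (diagNum e) =
      bif diagTest e (diagNum e) (a (diagBound e)) (b (diagBound e)) (c (diagBound e))
        then 0 else 2 := by
    rw [diagDigit, h1, h2, h3, he₁, he₂, he₃]
  have hxN := hx (diagBound e)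
  rw [abs_le] at hxN
  obtain ⟨hlo, hhi⟩ := hxN
  have hA : diagApprox e = (diagNum e : ℝ) / 3 ^ e := rfl
  have hsucc := diagApprox_succ e
  have hx1 := diagApprox_le_diagReal (e + 1)
  have hx2 := diagReal_le (e + 1)
  have hNval : ((diagBound e : ℕ) : ℝ) = 4 * 3 ^ (e + 1) := by simp [diagBound]
  have h3pos : (0 : ℝ) < 3 ^ (e + 1) := by positivity
  have h2N : 2 * (1 / (((diagBound e : ℕ) : ℝ) + 1)) < 1 / 3 ^ (e + 1) := by
    rw [← div_eq_mul_one_div, div_lt_div_iff₀ (by positivity) h3pos, hNval]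
    linarith
  have hT := diagTest_eq_true_iff e (diagNum e) (a (diagBound e)) (b (diagBound e)) (c (diagBound e))
  cases ht : diagTest e (diagNum e) (a (diagBound e)) (b (diagBound e)) (c (diagBound e))
  · -- the test fails: digit `2`, `x` lies in the right third
    rw [ht] at hdigit hT
    simp only [Bool.cond_false] at hdigit
    simp only [hdigit, Nat.cast_ofNat] at hsucc
    rw [div_eq_mul_one_div] at hsucc
    have hle := not_lt.mp (fun h => Bool.false_ne_true (hT.mpr h))
    linarith
  · -- the test holds: digit `0`, `x` lies in the left third
    rw [ht] at hdigit hT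
    simp only [Bool.cond_true] at hdigit
    simp only [hdigit, Nat.cast_zero, zero_div, add_zero] at hsucc
    have hlt := hT.mp rfl
    linarith

end YoshinagaDiagonal

/-- **A computable real number which is not elementary** (Yoshinaga, *Periods and elementary real
numbers*, arXiv:0805.0349 (2008), §2.3, Prop. 17 together with the computability of the
construction stated there and in §1: "we will also construct a computable real number which is
not elementary"). There is a real number which is computable (Weihrauch 2000, Def. 4.1.13:
it has a computable fast Cauchy name, `IsComputableReal`) but not elementary in the sense of
Tent–Ziegler / Yoshinaga Def. 9 (`IsElementaryReal`). The witness is `diagReal`; the proof is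
Yoshinaga's diagonal argument, run over the enumeration `primrecEnum` of all primitive recursive
(in particular, by `ElementaryRec.primrec_holds`, all Kalmár elementary) functions by Mathlib's
codes `Nat.Partrec.Code` instead of his enumeration by Mazzanti's basis (Prop. 13), and with the
candidate `e`-th approximation read at precision `N_e = 4·3^(e+1)` instead of his regularisation to
`7`-fast sequences. [cite: Yoshinaga2008, §2.3 Prop. 17] -/
theorem exists_isComputableReal_not_isElementaryReal :
    ∃ x : ℝ, IsComputableReal x ∧ ¬ IsElementaryReal x :=
  ⟨YoshinagaDiagonal.diagReal, YoshinagaDiagonal.isComputableReal_diagReal,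
    YoshinagaDiagonal.not_isElementaryReal_diagReal⟩

end Literature.Computability.Complexity
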